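import Mathlib.RingTheory.Flat.FaithfullyFlat.Algebra
import Mathlib.RingTheory.LocalRing.MaximalIdeal.Basic
import Mathlib.RingTheory.Ideal.Maps
import Mathlib.Algebra.Algebra.Basic
import HarnessLib

/-!
# Crux `FrobeniusLadder.FRationalResolution` (stmt-ResolutionOfSingularities-15317), line `redirect`,
# stub `stub_diagonalizableQuotientResolution` — «principal, generated by a nonzerodivisor» DESCENDS along faithfully flat
# ring maps into a local ring (stalkwise descent of Cartier-ness)

The Galois route's remaining obligation (`…GaloisSymmetrizedPieceRegular.symmetrizedPiece_isRegular_affineBlowup`, hypothesis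
`htw`) asks that certain extended ideals be principal and generated by a nonzerodivisor on the Rees charts of a blow-up of
`B' = B ⊗_K K'`, while the available information lives UPSTAIRS, on the étale (hence, at a point, faithfully flat) base change to
the chart. The ring-theoretic descent step: if `A → A'` is faithfully flat, `A'` is local, and the extension `I A'` of an ideal
`I ⊆ A` is `(u)` with `u` a nonzerodivisor, then `I = (v)` for some `v ∈ I` which is a nonzerodivisor of `A`, with `(v) A' = (u)`.
(Some `f(v)`, `v ∈ I`, generates `(u)`: otherwise `I A' ⊆ 𝔪'u` and `u ∈ 𝔪'u` forces `u = 0`; then `I ⊆ (v)A' ∩ A = (v)` by faithful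
flatness, and `v` is a nonzerodivisor because `f` is injective and `f(v)` is a unit multiple of `u`.)

* **`Ideal.exists_generator_of_map_eq_span_singleton`** — the statement above.

Honest label: generic commutative algebra toward ONE leaf stub (no stub, crux or summit closed). No definitions, no named facts,
no sorry. [cite: StacksProject, Tag 02OO; Tag 05B2]
-/

-- single-problem summit: the doubled namespace component is forced
set_option linter.dupNamespace false

namespace Summit.ResolutionOfSingularities.ResolutionOfSingularities.Theorems.FRationalResolution.PrincipalDescent

/-- **Descent of «principal, generated by a nonzerodivisor» along a faithfully flat map into a local ring.** `A → A'` faithfully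
flat, `A'` local, `I ⊆ A` an ideal with `I A' = (u)`, `u` a nonzerodivisor of `A'` ⇒ `I = (v)` for some `v ∈ I`, a nonzerodivisor of
`A`, with `(f v) = (u)`. [cite: StacksProject, Tag 02OO; Tag 05B2] -/
theorem Ideal.exists_generator_of_map_eq_span_singleton {A A' : Type*} [CommRing A] [CommRing A'] [Algebra A A']
    [IsLocalRing A'] [Module.FaithfullyFlat A A'] (I : Ideal A) (u : A') (hu : u ∈ nonZeroDivisors A')
    (h : I.map (algebraMap A A') = Ideal.span {u}) :
    ∃ v ∈ I, v ∈ nonZeroDivisors A ∧ I = Ideal.span {v} ∧ Ideal.span {algebraMap A A' v} = Ideal.span {u} := by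
  set f := algebraMap A A' with hf
  set 𝔪 : Ideal A' := IsLocalRing.maximalIdeal A' with h𝔪
  -- some `f v`, `v ∈ I`, lies outside `𝔪 · (u)`
  have hex : ∃ v ∈ I, f v ∉ 𝔪 * Ideal.span {u} := by
    by_contra hall
    have hall' : ∀ v ∈ I, f v ∈ 𝔪 * Ideal.span {u} := fun v hv => by
      by_contra hnot
      exact hall ⟨v, hv, hnot⟩
    have hle : I.map f ≤ 𝔪 * Ideal.span {u} := by
      rw [Ideal.map_le_iff_le_comap]
      intro v hv
      exact hall' v hv
    have huI : u ∈ I.map f := by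
      rw [h]
      exact Ideal.mem_span_singleton_self u
    obtain ⟨m, hm, hmu⟩ := Ideal.mem_mul_span_singleton.mp (hle huI)
    have hunit : IsUnit (1 - m) :=
      IsLocalRing.isUnit_one_sub_self_of_mem_nonunits m ((IsLocalRing.mem_maximalIdeal m).mp hm)
    have hu0 : u = 0 := by
      have h1 : (1 - m) * u = 0 := by rw [sub_mul, one_mul, hmu, sub_self]
      exact (hunit.mul_right_eq_zero).mp h1
    exact (nonZeroDivisors.ne_zero hu) hu0
  obtain ⟨v, hvI, hv⟩ := hex
  -- `f v = b u` with `b` a unit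
  have hfv : f v ∈ Ideal.span {u} := by
    rw [← h]
    exact Ideal.mem_map_of_mem f hvI
  obtain ⟨b, hb⟩ := Ideal.mem_span_singleton'.mp hfv
  have hbunit : IsUnit b := by
    by_contra hbn
    apply hv
    rw [← hb]
    exact Ideal.mul_mem_mul ((IsLocalRing.mem_maximalIdeal b).mpr hbn) (Ideal.mem_span_singleton_self u)
  have hspan : Ideal.span {f v} = Ideal.span {u} := by
    rw [← hb]
    exact Ideal.span_singleton_mul_left_unit hbunit u
  refine ⟨v, hvI, ?_, ?_, hspan⟩
  · -- `v` is a nonzerodivisor: `f` is injective and `f v` is a unit multiple of the nonzerodivisor `u`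
    refine mem_nonZeroDivisors_of_injective (f := f) (FaithfulSMul.algebraMap_injective A A') ?_
    rw [← hb]
    exact mul_mem hbunit.mem_nonZeroDivisors hu
  · -- `I = (v)`: `I ⊆ (v)A' ∩ A = (v)` by faithful flatness
    refine le_antisymm ?_ ((Ideal.span_singleton_le_iff_mem _).mpr hvI)
    have hcomap : (Ideal.span {v} : Ideal A) = ((Ideal.span {v}).map f).comap f :=
      (Ideal.comap_map_eq_self_of_faithfullyFlat (B := A') (Ideal.span {v})).symm
    rw [hcomap, Ideal.map_span, Set.image_singleton, hspan, ← h]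
    exact Ideal.le_comap_map

end Summit.ResolutionOfSingularities.ResolutionOfSingularities.Theorems.FRationalResolution.PrincipalDescent
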